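import Literature.AlgebraicGeometry.Motives.HodgeGroupOfCMFamilyRealPointsTorsion
import Literature.AlgebraicGeometry.HodgeTheory.CMAbelianVarietyHodgeGroupRealPointsCompactForm
import Literature.AlgebraicGeometry.HodgeTheory.CMBettiHodgeGroupRealPoints
import HarnessLib

/-!
# Torsion and divisibility of `Hg(A, ℝ)` ON ACTUAL CM ABELIAN VARIETIES: the torsion of `MT(H¹(A))(ℝ)` lies in `Hg(H¹(A))(ℝ)`
# for every complex abelian variety of CM type; for `A` realising a CM type `(K; Φ)` and for products `∏ᵢ Aᵢ`,
# `Hg(H¹)(ℝ)` is divisible and `#Hg(H¹)(ℝ)[n] = #MT(H¹)(ℝ)[n] = n^{rank - 1}`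
# (Deligne 1982 I proof of 3.6 / Ex. 3.7 / §5; Gordon 2.12–2.13; Milne, *Algebraic Groups*, Ch. 12)

Family `hodge`, lane `lit-hodgefound` (Track 2 foundations library; Layer A3), layer `Literature/AlgebraicGeometry/HodgeTheory`.  THEOREMS
ONLY (no definition, no named fact; D-0026 net debt `0`).  The Betti TRANSPORT of the seat's `Motives/HodgeGroupOfCMFamilyRealPointsTorsion`
(§2 there: torsion real points of `MT(H)` commuting with `C_ℝ` lie in `Hg(H)(ℝ)`; §3: divisibility and torsion counts for the CM
algebra) along the tree's identifications: the CM condition of `HodgeTheory/CMAbelianVarietyHodgeGroupRealPointsCompactForm`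
(`hodgeLie_hodge_le_endAlg_of_isOfCMType`, `CMBettiModel.hodgeLie_pi_hodge_le_endAlg`) and the abstract-group isomorphisms
`Hg(H¹(A))(ℝ) ≅ U(1)^{rank Φ - 1}`, `Hg(⊕ᵢ H¹(Aᵢ))(ℝ) ≅ U(1)^{rank Σ - 1}`, `Hg(V¹_{(K,Φ)})(ℝ) ≅ U(1)^{rank Φ - 1}` of
`HodgeTheory/CMBettiHodgeGroupRealPoints`.

THE PRINTS.  J. S. Milne, *Algebraic Groups* (CUP 2017) [Milne2017] Ch. 12: **Example 12.27 (b)** «Thus `G(ℝ) = {z ∈ ℂ^× ∣ z z̄ = 1}`,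
which is compact.», **Exercise 12-7** (real tori are products of `𝔾_m`, `U₁`, `(𝔾_m)_{ℂ/ℝ}`; `T(ℝ)` compact iff `T` anisotropic).
P. Deligne (1982) [Deligne1982HodgeCycles] I proof of Prop. 3.6 (p0025) «this real-form is compact», Example 3.7 (p0026) «`G` is a
torus», §5 «of CM-type if its Mumford-Tate group is commutative».  B. B. Gordon [Gordon1999HodgeAVSurvey] 2.12 «of CM-type if and only
if `Hg(A)` is an algebraic torus», 2.13 «nondegenerate if `dim Hg(A) = dim A`».  M. Green, P. Griffiths, M. Kerr [GreenGriffithsKerr2012]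
§I.B «`M_φ̃ = 𝔾_m · M_φ` (almost direct product)».  B. Moonen [Moonen2004MT] (5.8).

THE OBJECTS (all the tree's).  `X : SchemeOver ℂ` smooth projective, `Hᵏ(X) = BettiUniverse.hodge hHD hX k`; `A : AbelianVariety ℂ` with
`Milne1999.IsOfCMType A`; a realisation `h : IsCMTypeRealisation Φ A ι θ` of a CM type `Φ` of a CM field `K`
(`rank Φ = Pohlmann1968.cmTypeRank Φ`); a finite family `hA i` of such (`rank Σ = CMAlgebra.cmFamilyRank Φ`) and
`⊕ᵢ H¹(Aᵢ) = HodgeStructure.pi …`; the model `V¹_{(K,Φ)} = ofCMType Φ`; real points `MT(ℝ)`, `Hg(ℝ)` as subgroups of `GL(ℝ ⊗ H¹)`,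
`n`-torsion `{γ | γⁿ = 1}` counted with `Nat.card`.

WHAT IS PROVED.
* §0 (private subgroup bookkeeping) `natCard_pow_eq_one_eq_of_le` (if `S ≤ T` contains all torsion of `T`, `#T[n] = #S[n]`).
* §1 (model `V¹_{(K,Φ)}`, `K` CM) `exists_pow_eq_of_mem_hodgeGroupBaseChange_real_ofCMType` (divisible),
  **`natCard_hodgeGroupBaseChange_real_ofCMType_pow_eq_one`** (`#Hg(V¹_{(K,Φ)})(ℝ)[n] = n^{rank Φ - 1}`),
  `mem_hodgeGroupBaseChange_real_ofCMType_of_pow_eq_one` (`MT(ℝ)_tors ⊆ Hg(ℝ)`), `natCard_mumfordTateGroupBaseChange_real_ofCMType_pow_eq_one`.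
* §2 (every smooth projective `X`, odd `k`, `Hᵏ(X) ≠ 0`) **`mem_hodgeGroupBaseChange_hodge_real_of_pow_eq_one_of_comm`** (torsion real
  points of `MT(Hᵏ(X))` commuting with `C_ℝ` lie in `Hg(Hᵏ(X))(ℝ)`); (every `A` of CM type, `H¹(A) ≠ 0`)
  **`mem_hodgeGroupBaseChange_hodge_real_of_pow_eq_one_of_isOfCMType`** — **`MT(H¹(A))(ℝ)_tors ⊆ Hg(H¹(A))(ℝ)`**.
* §3 (one realisation `h`) **`CMBettiModel.exists_pow_eq_of_mem_hodgeGroupBaseChange_hodge_real`** (`Hg(H¹(A))(ℝ)` divisible),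
  **`CMBettiModel.natCard_hodgeGroupBaseChange_hodge_real_pow_eq_one`** (`= n^{rank Φ - 1}`),
  `CMBettiModel.natCard_hodgeGroupBaseChange_hodge_real_pow_eq_one_of_isNondegenerate` (`= n^{[K:ℚ]/2} = n^{dim A}`),
  `CMBettiModel.mem_hodgeGroupBaseChange_hodge_real_of_pow_eq_one`, `CMBettiModel.natCard_mumfordTateGroupBaseChange_hodge_real_pow_eq_one`.
* §4 (products) `CMBettiModel.exists_pow_eq_of_mem_hodgeGroupBaseChange_pi_hodge_real`,
  **`CMBettiModel.natCard_hodgeGroupBaseChange_pi_hodge_real_pow_eq_one`** (`= n^{rank Σ - 1}`),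
  `CMBettiModel.mem_hodgeGroupBaseChange_pi_hodge_real_of_pow_eq_one`, `CMBettiModel.natCard_mumfordTateGroupBaseChange_pi_hodge_real_pow_eq_one`.

DEVIATIONS / SCOPE.  On points; abstract-group statements only (no topology on `GL(ℝ ⊗ H¹)`).  NOT HERE: `ℓ`-adic points; even degrees.

## References
* [Milne2017] J. S. Milne, *Algebraic Groups*, CUP (2017) — Ch. 12: 12.26, Example 12.27 (b), Exercise 12-7.
* [Deligne1982HodgeCycles] P. Deligne, *Hodge cycles on abelian varieties*, in LNM 900 (1982) — I proof of Prop. 3.6, Example 3.7, §5.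
* [Gordon1999HodgeAVSurvey] B. B. Gordon, *A survey of the Hodge conjecture for abelian varieties* (1999) — 2.12, 2.13.
* [GreenGriffithsKerr2012] M. Green, P. A. Griffiths, M. Kerr, *Mumford–Tate Groups and Domains* (2012) — §I.B (before (I.B.1)).
* [Moonen2004MT] B. Moonen, *An introduction to Mumford–Tate groups* (2004) — (5.8).

## Provenance
Lane `lit-hodgefound` (Hodge path, Track 2), prover seat `lit-hodgefound-p29` (generation 22), self-proposed row g22-#6 (Betti sequel of
g22-#5 `Motives/HodgeGroupOfCMFamilyRealPointsTorsion`).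
-/

noncomputable section

open scoped TensorProduct Classical
open CategoryTheory Module NumberField

/-! ### §0 Subgroup bookkeeping: if `S ≤ T` contains the torsion of `T`, the `n`-torsion of `T` and of `S` coincide -/

namespace Literature.AlgebraicGeometry.Motives

namespace HodgeStructure

universe w

/-- For subgroups `S ≤ T` of a group such that every element of `T` with `γⁿ = 1` lies in `S`, the `n`-torsion of `T` and of `S`
have the same cardinality (they are in bijection by the inclusion). [folklore] -/
private theorem natCard_pow_eq_one_eq_of_le {G : Type w} [Group G] {S T : Subgroup G} (hST : S ≤ T) {n : ℕ}
    (h : ∀ γ ∈ T, γ ^ n = 1 → γ ∈ S) :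
    Nat.card {γ : T // γ ^ n = 1} = Nat.card {γ : S // γ ^ n = 1} := by
  have key : ∀ (U : Subgroup G) (x : U), x ^ n = 1 ↔ (x : G) ^ n = 1 := fun U x => by
    rw [Subtype.ext_iff, SubgroupClass.coe_pow, OneMemClass.coe_one]
  exact Nat.card_congr
    { toFun := fun γ => ⟨⟨γ.1.1, h _ γ.1.2 ((key T γ.1).1 γ.2)⟩, (key S _).2 ((key T γ.1).1 γ.2)⟩
      invFun := fun δ => ⟨⟨δ.1.1, hST δ.1.2⟩, (key T _).2 ((key S δ.1).1 δ.2)⟩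
      left_inv := fun γ => rfl
      right_inv := fun δ => rfl }

/-! ### §1 The model `V¹_{(K,Φ)}` -/

section OneType

variable {K : Type} [Field K] [NumberField K] [IsCMField K] (Φ : CMType K) [HodgeTensorFacts.{0, 0}]

/-- **`Hg(V¹_{(K,Φ)})(ℝ)` is divisible** (`≅ U(1)^{rank Φ - 1}`, the tree's `nonempty_hodgeGroupBaseChange_real_ofCMType_mulEquiv_pi_circle`).
[cite: Milne2017, Ch. 12, Example 12.27 (b) and Exercise 12-7] [cite: Deligne1982HodgeCycles, I Example 3.7 (p. 26)] -/
theorem exists_pow_eq_of_mem_hodgeGroupBaseChange_real_ofCMType {γ : (ℝ ⊗[ℚ] K) ≃ₗ[ℝ] (ℝ ⊗[ℚ] K)}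
    (hγ : γ ∈ (ofCMType Φ).hodgeGroupBaseChange ℝ) {n : ℕ} (hn : n ≠ 0) :
    ∃ δ ∈ (ofCMType Φ).hodgeGroupBaseChange ℝ, δ ^ n = γ := by
  obtain ⟨e⟩ := nonempty_hodgeGroupBaseChange_real_ofCMType_mulEquiv_pi_circle Φ
  obtain ⟨h, hh⟩ := exists_pow_eq_of_mulEquiv_pi_circle e ⟨γ, hγ⟩ hn
  exact ⟨h, h.2, by rw [← SubgroupClass.coe_pow, hh]⟩

/-- **`#Hg(V¹_{(K,Φ)})(ℝ)[n] = n^{rank Φ - 1}`** (`n ≠ 0`). [cite: Milne2017, Ch. 12, Example 12.27 (b) and Exercise 12-7]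
[cite: Gordon1999HodgeAVSurvey, Prop. 2.12 and Definition 2.13] -/
theorem natCard_hodgeGroupBaseChange_real_ofCMType_pow_eq_one {n : ℕ} (hn : n ≠ 0) :
    Nat.card {γ : (ofCMType Φ).hodgeGroupBaseChange ℝ // γ ^ n = 1} = n ^ (Pohlmann1968.cmTypeRank Φ - 1) := by
  obtain ⟨e⟩ := nonempty_hodgeGroupBaseChange_real_ofCMType_mulEquiv_pi_circle Φ
  rw [natCard_pow_eq_one_of_mulEquiv_pi_circle e hn, Fintype.card_fin]

/-- **`MT(V¹_{(K,Φ)})(ℝ)_tors ⊆ Hg(V¹_{(K,Φ)})(ℝ)`**. [cite: GreenGriffithsKerr2012, §I.B (semi-direct product remark before (I.B.1))]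
[cite: Moonen2004MT, (5.8)] -/
theorem mem_hodgeGroupBaseChange_real_ofCMType_of_pow_eq_one {γ : (ℝ ⊗[ℚ] K) ≃ₗ[ℝ] (ℝ ⊗[ℚ] K)}
    (hγ : γ ∈ (ofCMType Φ).mumfordTateGroupBaseChange ℝ) {m : ℕ} (hm : m ≠ 0) (hpow : γ ^ m = 1) :
    γ ∈ (ofCMType Φ).hodgeGroupBaseChange ℝ :=
  mem_hodgeGroupBaseChange_real_of_pow_eq_one_of_hodgeLie_le (ofCMType Φ) odd_one (isPolarizable_ofCMType Φ)
    (hodgeLie_ofCMType_le_endAlg Φ) hγ hm hpow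

/-- **`#MT(V¹_{(K,Φ)})(ℝ)[n] = n^{rank Φ - 1}`** (`n ≠ 0`). [cite: Milne2017, Ch. 12, Example 12.27 (b) and Exercise 12-7]
[cite: GreenGriffithsKerr2012, §I.B (semi-direct product remark before (I.B.1))] -/
theorem natCard_mumfordTateGroupBaseChange_real_ofCMType_pow_eq_one {n : ℕ} (hn : n ≠ 0) :
    Nat.card {γ : (ofCMType Φ).mumfordTateGroupBaseChange ℝ // γ ^ n = 1} = n ^ (Pohlmann1968.cmTypeRank Φ - 1) := by
  rw [← natCard_hodgeGroupBaseChange_real_ofCMType_pow_eq_one Φ hn]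
  exact natCard_pow_eq_one_eq_of_le (hodgeGroupBaseChange_le_mumfordTateGroupBaseChange ℝ (ofCMType Φ))
    fun γ hγ hpow => mem_hodgeGroupBaseChange_real_ofCMType_of_pow_eq_one Φ hγ hn hpow

end OneType

end HodgeStructure

end Literature.AlgebraicGeometry.Motives

namespace Literature.AlgebraicGeometry.HodgeTheory

open Literature.AlgebraicGeometry.Motives
open Literature.AlgebraicGeometry.Motives.HodgeStructure
open Literature.AlgebraicGeometry.Milne1999 (IsOfCMType)
open Literature.AlgebraicGeometry.ComplexMultiplication (IsCMTypeRealisation)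

/-! ### §2 Every smooth projective `X` (odd degree) and every complex abelian variety of CM type -/

section General

variable [HodgeTensorFacts.{0, 0}] {n : ℕ} {X : SchemeOver ℂ} {k : ℕ} [Module.Finite ℚ (bettiCohomology X k)]

/-- **Torsion real points of `MT(Hᵏ(X))` commuting with `C_ℝ` lie in `Hg(Hᵏ(X))(ℝ)`** for every smooth projective `X` and odd `k`
(`Hᵏ(X) ≠ 0`; `Hᵏ(X)` is polarizable by the Hodge–Riemann relations). [cite: GreenGriffithsKerr2012, §I.B (semi-direct product remark before (I.B.1))]
[cite: Moonen2004MT, (5.8)] [cite: Deligne1982HodgeCycles, I §3 proof of Prop. 3.6 (p. 25)] -/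
theorem mem_hodgeGroupBaseChange_hodge_real_of_pow_eq_one_of_comm [Nontrivial (bettiCohomology X k)]
    (hHD : exists_isReal_hodgeModel) (hX : IsSmoothProjective n X) (hk : Odd k)
    {γ : (ℝ ⊗[ℚ] bettiCohomology X k) ≃ₗ[ℝ] (ℝ ⊗[ℚ] bettiCohomology X k)}
    (hγ : γ ∈ (BettiUniverse.hodge hHD hX k).mumfordTateGroupBaseChange ℝ)
    (hC : ∀ a, γ ((BettiUniverse.hodge hHD hX k).realWeilOperator a) = (BettiUniverse.hodge hHD hX k).realWeilOperator (γ a))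
    {m : ℕ} (hm : m ≠ 0) (hpow : γ ^ m = 1) : γ ∈ (BettiUniverse.hodge hHD hX k).hodgeGroupBaseChange ℝ :=
  mem_hodgeGroupBaseChange_real_of_pow_eq_one_of_comm _ ((Int.odd_coe_nat k).2 hk) (BettiUniverse.hodge_isPolarizable hHD hX k)
    hγ hC hm hpow

end General

section OfCMType

variable [HodgeTensorFacts.{0, 0}] {A : AbelianVariety ℂ} {n : ℕ} [Module.Finite ℚ (bettiCohomology A.X 1)]

/-- **`MT(H¹(A))(ℝ)_tors ⊆ Hg(H¹(A))(ℝ)` for EVERY complex abelian variety `A` of CM type** (`H¹(A) ≠ 0`): in the almost-direct product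
`MT(H¹(A))(ℝ) = ℝ^×_{>0} · Hg(H¹(A))(ℝ)` the factor `ℝ^×_{>0}` is torsion-free. [cite: GreenGriffithsKerr2012, §I.B (semi-direct product remark before (I.B.1))]
[cite: Deligne1982HodgeCycles, I §5 (definition of CM-type)] [cite: Gordon1999HodgeAVSurvey, Prop. 2.12] -/
theorem mem_hodgeGroupBaseChange_hodge_real_of_pow_eq_one_of_isOfCMType [Nontrivial (bettiCohomology A.X 1)]
    (hHD : exists_isReal_hodgeModel) (hI : hodgePQ_independent_of_hodgeModel) (hA : IsSmoothProjective n A.X) (hcm : IsOfCMType A)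
    {γ : (ℝ ⊗[ℚ] bettiCohomology A.X 1) ≃ₗ[ℝ] (ℝ ⊗[ℚ] bettiCohomology A.X 1)}
    (hγ : γ ∈ (BettiUniverse.hodge hHD hA 1).mumfordTateGroupBaseChange ℝ) {m : ℕ} (hm : m ≠ 0) (hpow : γ ^ m = 1) :
    γ ∈ (BettiUniverse.hodge hHD hA 1).hodgeGroupBaseChange ℝ :=
  mem_hodgeGroupBaseChange_real_of_pow_eq_one_of_hodgeLie_le _ odd_one (BettiUniverse.hodge_isPolarizable hHD hA 1)
    (hodgeLie_hodge_le_endAlg_of_isOfCMType hHD hI hA hcm) hγ hm hpow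

end OfCMType

/-! ### §3 One CM abelian variety realising `(K; Φ)` -/

namespace CMBettiModel

section One

variable {K : Type} [Field K] [NumberField K] [IsCMField K] {Φ : CMType K} {A : AbelianVariety ℂ} {ι : 𝓞 K →+* End A}
  {θ : K →+* Module.End ℂ (complexBetti A.X 1)} [HodgeTensorFacts.{0, 0}] [Module.Finite ℚ (bettiCohomology A.X 1)]

/-- **`Hg(H¹(A))(ℝ)` is divisible** for a CM abelian variety `A` of type `(K; Φ)` (`≅ U(1)^{rank Φ - 1}`, the tree's
`nonempty_hodgeGroupBaseChange_hodge_real_mulEquiv_pi_circle`). [cite: Milne2017, Ch. 12, Example 12.27 (b) and Exercise 12-7]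
[cite: Deligne1982HodgeCycles, I proof of Prop. 3.6 and Example 3.7 (pp. 25–26)] -/
theorem exists_pow_eq_of_mem_hodgeGroupBaseChange_hodge_real (h : IsCMTypeRealisation Φ A ι θ) (hHD : exists_isReal_hodgeModel)
    (hI : hodgePQ_independent_of_hodgeModel) {γ : (ℝ ⊗[ℚ] bettiCohomology A.X 1) ≃ₗ[ℝ] (ℝ ⊗[ℚ] bettiCohomology A.X 1)}
    (hγ : γ ∈ (BettiUniverse.hodge hHD h.1 1).hodgeGroupBaseChange ℝ) {n : ℕ} (hn : n ≠ 0) :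
    ∃ δ ∈ (BettiUniverse.hodge hHD h.1 1).hodgeGroupBaseChange ℝ, δ ^ n = γ := by
  obtain ⟨e⟩ := nonempty_hodgeGroupBaseChange_hodge_real_mulEquiv_pi_circle h hHD hI
  obtain ⟨g, hg⟩ := exists_pow_eq_of_mulEquiv_pi_circle e ⟨γ, hγ⟩ hn
  exact ⟨g, g.2, by rw [← SubgroupClass.coe_pow, hg]⟩

/-- **`#Hg(H¹(A))(ℝ)[n] = n^{rank Φ - 1}`** for a CM abelian variety `A` of type `(K; Φ)` (`n ≠ 0`): the `n`-torsion of the real points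
of the Hodge group is finite of this cardinality — the shadow of «`Hg(A)_ℝ` is a compact torus of dimension `rank Φ - 1`».
[cite: Milne2017, Ch. 12, Example 12.27 (b) and Exercise 12-7] [cite: Gordon1999HodgeAVSurvey, Prop. 2.12 and Definition 2.13] -/
theorem natCard_hodgeGroupBaseChange_hodge_real_pow_eq_one (h : IsCMTypeRealisation Φ A ι θ) (hHD : exists_isReal_hodgeModel)
    (hI : hodgePQ_independent_of_hodgeModel) {n : ℕ} (hn : n ≠ 0) :
    Nat.card {γ : (BettiUniverse.hodge hHD h.1 1).hodgeGroupBaseChange ℝ // γ ^ n = 1} = n ^ (Pohlmann1968.cmTypeRank Φ - 1) := by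
  obtain ⟨e⟩ := nonempty_hodgeGroupBaseChange_hodge_real_mulEquiv_pi_circle h hHD hI
  rw [natCard_pow_eq_one_of_mulEquiv_pi_circle e hn, Fintype.card_fin]

/-- **Nondegenerate type: `#Hg(H¹(A))(ℝ)[n] = n^{[K:ℚ]/2} = n^{dim A}`** (Gordon 2.13 on real points: `Hg(H¹(A))(ℝ) ≅ U(1)^{dim A}`).
[cite: Gordon1999HodgeAVSurvey, §2 Definition 2.13] [cite: Milne2017, Ch. 12, Example 12.27 (b) and Exercise 12-7] -/
theorem natCard_hodgeGroupBaseChange_hodge_real_pow_eq_one_of_isNondegenerate (h : IsCMTypeRealisation Φ A ι θ)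
    (hHD : exists_isReal_hodgeModel) (hI : hodgePQ_independent_of_hodgeModel) (hΦ : Pohlmann1968.IsNondegenerate Φ)
    {n : ℕ} (hn : n ≠ 0) :
    Nat.card {γ : (BettiUniverse.hodge hHD h.1 1).hodgeGroupBaseChange ℝ // γ ^ n = 1} = n ^ (Module.finrank ℚ K / 2) := by
  obtain ⟨e⟩ := nonempty_hodgeGroupBaseChange_hodge_real_mulEquiv_pi_circle_of_isNondegenerate h hHD hI hΦ
  rw [natCard_pow_eq_one_of_mulEquiv_pi_circle e hn, Fintype.card_fin]

omit [IsCMField K] in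
/-- **`MT(H¹(A))(ℝ)_tors ⊆ Hg(H¹(A))(ℝ)`** for a CM abelian variety `A` of type `(K; Φ)`. [cite: GreenGriffithsKerr2012, §I.B (semi-direct product remark before (I.B.1))]
[cite: Moonen2004MT, (5.8)] -/
theorem mem_hodgeGroupBaseChange_hodge_real_of_pow_eq_one (h : IsCMTypeRealisation Φ A ι θ) (hHD : exists_isReal_hodgeModel)
    (hI : hodgePQ_independent_of_hodgeModel) {γ : (ℝ ⊗[ℚ] bettiCohomology A.X 1) ≃ₗ[ℝ] (ℝ ⊗[ℚ] bettiCohomology A.X 1)}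
    (hγ : γ ∈ (BettiUniverse.hodge hHD h.1 1).mumfordTateGroupBaseChange ℝ) {m : ℕ} (hm : m ≠ 0) (hpow : γ ^ m = 1) :
    γ ∈ (BettiUniverse.hodge hHD h.1 1).hodgeGroupBaseChange ℝ := by
  obtain ⟨e, -, -⟩ := exists_ofCMType_eq_comapEquiv h hHD hI
  haveI : Nontrivial (bettiCohomology A.X 1) := e.symm.toEquiv.nontrivial
  exact mem_hodgeGroupBaseChange_real_of_pow_eq_one_of_hodgeLie_le _ odd_one (BettiUniverse.hodge_isPolarizable hHD h.1 1)
    (hodgeLie_hodge_le_endAlg h hHD hI) hγ hm hpow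

/-- **`#MT(H¹(A))(ℝ)[n] = n^{rank Φ - 1}`** for a CM abelian variety `A` of type `(K; Φ)` (`n ≠ 0`).
[cite: Milne2017, Ch. 12, Example 12.27 (b) and Exercise 12-7] [cite: GreenGriffithsKerr2012, §I.B (semi-direct product remark before (I.B.1))] -/
theorem natCard_mumfordTateGroupBaseChange_hodge_real_pow_eq_one (h : IsCMTypeRealisation Φ A ι θ)
    (hHD : exists_isReal_hodgeModel) (hI : hodgePQ_independent_of_hodgeModel) {n : ℕ} (hn : n ≠ 0) :
    Nat.card {γ : (BettiUniverse.hodge hHD h.1 1).mumfordTateGroupBaseChange ℝ // γ ^ n = 1} = n ^ (Pohlmann1968.cmTypeRank Φ - 1) := by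
  rw [← natCard_hodgeGroupBaseChange_hodge_real_pow_eq_one h hHD hI hn]
  exact natCard_pow_eq_one_eq_of_le (hodgeGroupBaseChange_le_mumfordTateGroupBaseChange ℝ _)
    fun γ hγ hpow => mem_hodgeGroupBaseChange_hodge_real_of_pow_eq_one h hHD hI hγ hn hpow

end One

/-! ### §4 Products `∏ᵢ Aᵢ` of CM abelian varieties -/

section Product

variable {I : Type} [Fintype I] [DecidableEq I] {K : I → Type} [∀ i, Field (K i)] [∀ i, NumberField (K i)]
  [∀ i, IsCMField (K i)] {Φ : ∀ i, CMType (K i)} {A : I → AbelianVariety ℂ} {ι : ∀ i, 𝓞 (K i) →+* End (A i)}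
  {θ : ∀ i, K i →+* Module.End ℂ (complexBetti (A i).X 1)} [HodgeTensorFacts.{0, 0}]
  [∀ i, Module.Finite ℚ (bettiCohomology (A i).X 1)] [Nontrivial (∀ i, K i)]

/-- **`Hg(⊕ᵢ H¹(Aᵢ))(ℝ)` is divisible** (products of CM abelian varieties; `≅ U(1)^{rank Σ - 1}`).
[cite: Milne2017, Ch. 12, Example 12.27 (b) and Exercise 12-7] [cite: Deligne1982HodgeCycles, I Example 3.7 (p. 26)] -/
theorem exists_pow_eq_of_mem_hodgeGroupBaseChange_pi_hodge_real (hA : ∀ i, IsCMTypeRealisation (Φ i) (A i) (ι i) (θ i))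
    (hHD : exists_isReal_hodgeModel) (hI : hodgePQ_independent_of_hodgeModel)
    {γ : (ℝ ⊗[ℚ] (∀ i, bettiCohomology (A i).X 1)) ≃ₗ[ℝ] (ℝ ⊗[ℚ] (∀ i, bettiCohomology (A i).X 1))}
    (hγ : γ ∈ (HodgeStructure.pi fun i => BettiUniverse.hodge hHD (hA i).1 1).hodgeGroupBaseChange ℝ) {n : ℕ} (hn : n ≠ 0) :
    ∃ δ ∈ (HodgeStructure.pi fun i => BettiUniverse.hodge hHD (hA i).1 1).hodgeGroupBaseChange ℝ, δ ^ n = γ := by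
  obtain ⟨e⟩ := nonempty_hodgeGroupBaseChange_pi_hodge_real_mulEquiv_pi_circle hA hHD hI
  obtain ⟨g, hg⟩ := exists_pow_eq_of_mulEquiv_pi_circle e ⟨γ, hγ⟩ hn
  exact ⟨g, g.2, by rw [← SubgroupClass.coe_pow, hg]⟩

/-- **`#Hg(⊕ᵢ H¹(Aᵢ))(ℝ)[n] = n^{rank Σ - 1}`** (`n ≠ 0`; products of CM abelian varieties).
[cite: Milne2017, Ch. 12, Example 12.27 (b) and Exercise 12-7] [cite: Gordon1999HodgeAVSurvey, Prop. 2.12, 7.5 (3)] -/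
theorem natCard_hodgeGroupBaseChange_pi_hodge_real_pow_eq_one (hA : ∀ i, IsCMTypeRealisation (Φ i) (A i) (ι i) (θ i))
    (hHD : exists_isReal_hodgeModel) (hI : hodgePQ_independent_of_hodgeModel) {n : ℕ} (hn : n ≠ 0) :
    Nat.card {γ : (HodgeStructure.pi fun i => BettiUniverse.hodge hHD (hA i).1 1).hodgeGroupBaseChange ℝ // γ ^ n = 1} =
      n ^ (Pohlmann1968.CMAlgebra.cmFamilyRank Φ - 1) := by
  obtain ⟨e⟩ := nonempty_hodgeGroupBaseChange_pi_hodge_real_mulEquiv_pi_circle hA hHD hI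
  rw [natCard_pow_eq_one_of_mulEquiv_pi_circle e hn, Fintype.card_fin]

omit [Nontrivial (∀ i, K i)] [∀ i, IsCMField (K i)] in
/-- **`MT(⊕ᵢ H¹(Aᵢ))(ℝ)_tors ⊆ Hg(⊕ᵢ H¹(Aᵢ))(ℝ)`** (products of CM abelian varieties, `⊕ᵢ H¹(Aᵢ; ℚ) ≠ 0`).
[cite: GreenGriffithsKerr2012, §I.B (semi-direct product remark before (I.B.1))] [cite: Moonen2004MT, (5.8)] -/
theorem mem_hodgeGroupBaseChange_pi_hodge_real_of_pow_eq_one [Nontrivial (∀ i, bettiCohomology (A i).X 1)]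
    (hA : ∀ i, IsCMTypeRealisation (Φ i) (A i) (ι i) (θ i)) (hHD : exists_isReal_hodgeModel) (hI : hodgePQ_independent_of_hodgeModel)
    {γ : (ℝ ⊗[ℚ] (∀ i, bettiCohomology (A i).X 1)) ≃ₗ[ℝ] (ℝ ⊗[ℚ] (∀ i, bettiCohomology (A i).X 1))}
    (hγ : γ ∈ (HodgeStructure.pi fun i => BettiUniverse.hodge hHD (hA i).1 1).mumfordTateGroupBaseChange ℝ)
    {m : ℕ} (hm : m ≠ 0) (hpow : γ ^ m = 1) :
    γ ∈ (HodgeStructure.pi fun i => BettiUniverse.hodge hHD (hA i).1 1).hodgeGroupBaseChange ℝ :=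
  mem_hodgeGroupBaseChange_real_of_pow_eq_one_of_hodgeLie_le _ odd_one
    (IsPolarizable.pi (H := fun i => BettiUniverse.hodge hHD (hA i).1 1) fun i => BettiUniverse.hodge_isPolarizable hHD (hA i).1 1)
    (hodgeLie_pi_hodge_le_endAlg hA hHD hI) hγ hm hpow

/-- **`#MT(⊕ᵢ H¹(Aᵢ))(ℝ)[n] = n^{rank Σ - 1}`** (`n ≠ 0`; products of CM abelian varieties, `⊕ᵢ H¹(Aᵢ; ℚ) ≠ 0`).
[cite: Milne2017, Ch. 12, Example 12.27 (b) and Exercise 12-7] [cite: GreenGriffithsKerr2012, §I.B (semi-direct product remark before (I.B.1))] -/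
theorem natCard_mumfordTateGroupBaseChange_pi_hodge_real_pow_eq_one [Nontrivial (∀ i, bettiCohomology (A i).X 1)]
    (hA : ∀ i, IsCMTypeRealisation (Φ i) (A i) (ι i) (θ i)) (hHD : exists_isReal_hodgeModel) (hI : hodgePQ_independent_of_hodgeModel)
    {n : ℕ} (hn : n ≠ 0) :
    Nat.card {γ : (HodgeStructure.pi fun i => BettiUniverse.hodge hHD (hA i).1 1).mumfordTateGroupBaseChange ℝ // γ ^ n = 1} =
      n ^ (Pohlmann1968.CMAlgebra.cmFamilyRank Φ - 1) := by
  rw [← natCard_hodgeGroupBaseChange_pi_hodge_real_pow_eq_one hA hHD hI hn]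
  exact natCard_pow_eq_one_eq_of_le (hodgeGroupBaseChange_le_mumfordTateGroupBaseChange ℝ _)
    fun γ hγ hpow => mem_hodgeGroupBaseChange_pi_hodge_real_of_pow_eq_one hA hHD hI hγ hn hpow

end Product

end CMBettiModel

end Literature.AlgebraicGeometry.HodgeTheory

end
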